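/-
COR-CM (cells pub-hodgecm / pub-hodgecm2, stage 2 of the Hodge ladder) — Δ2 BRIDGE, S1 AT THE PIN, RE-KEYED FOR THE CONJUGATE INSTANCE
(WALL-BREAKER 2 of DECISION #13's ι₁/ῑ₁ instance seam; seat prover-pub-hodgecm2-d2bridge-wb-2-g0-0).  ῑ₁ := (starRingEnd ℂ).comp ι₁.
THE WALL (DECISION #13, HOME/INBOX l. 11366): the J value of the (c)+(d) half of the Δ2 bridge exists only under `ῑ₁.toAlgebra` (the tree
cofan `AlbaneseOnPieceCofan.exists_treeCofan_X_baseChange_sec42DataOf` is along `ῑ₁`), while the landed S1 junction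
`HcmS1PinJunction.exists_dLiu_of_objOne` opens with `obtain rfl : inst = ι₁.toAlgebra`.  THIS FILE is the PRIMED TWIN of that junction
under the conjugate instance, ON THE SHARED ι₁-PRESENTED TAIL:
* §1 `nonempty_cmDatum_conj_iff` — `𝒜(μ)` presented through `ῑ₁` is inhabited iff through `ι₁`, with the same `(A_μ, i_μ)` (only `det45`
  mentions the presentation, through `η_μ`, and ✔ `Def45.eta_starRingEnd_comp`);
* §2 `exists_dLiu_of_objOne_conj` — THE PRIMED TWIN (statement in its docstring); its admissibility clause is stated in the `ῑ₁`-reading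
  `IsReflexOfTypeG ῑ₁ Φ_μ`, which the landed seam lemma ✔ `ReflexOfTypeConj.isReflexOfTypeG_conj_iff` converts, in one rewrite, into the
  DICTIONARY's `ι₁`-reading at the CONJUGATE type, `IsReflexOfTypeG ι₁ (CMTypeOps.bar Φ_μ)` (corollary filed separately once that module
  has a farm olean; this file deliberately does not import it).
Theorems only: no definition, no instance, no named fact; nothing landed is edited or restated.  FRAMING: HC_CM is NOT proved;
«Δ2 BRIDGE CLOSED» is NOT claimed; no pointer moves; the twin meets the dictionary's `adm i = IsReflexOfTypeG ι₁ (typeOfLine (line i))`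
exactly when `typeOfLine (line i)` is CONJUGATE to the rest's `Φ_μ` (a conjugate rest), NOT at the rest of record.
-/
import Summits.HodgeConjecture.CorCM.D2Bridge.HcmS1PinJunction
import Literature.NumberTheory.Automorphic.Liu2021.Def45EtaConjugate
import HarnessLib

set_option autoImplicit false

/-!
# Δ2 bridge, S1 at the pin under the conjugate instance `ῑ₁`: the admissibility bridge and the primed twin

* `nonempty_cmDatum_conj_iff` — `ObjOne … ῑ₁ …` is inhabited iff `ObjOne … ι₁ …` is;
* `baseChange_hOneAlgHom_of_lineModuleOne_inst` — the currency lemma of `HcmS1PinJunction` for the AMBIENT `Algebra L ℂ`;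
* `exists_dLiu_of_objOne_conj` — `∃ dLiu u, (∀ Φ' = Φ_μ, ∀ q, (dLiu q).IsReflexOfTypeG ῑ₁ Φ') ∧
  ∀ q Y f, (f ≫ u q)^*_ℂ (dLiu q).α = (q : ℂ) • f^*_ℂ α₀`, under `algebraMap L ℂ = ῑ₁`, for `D : ObjOne (AlgHom.id ℚ L) ι₁ …`.

References: Y. Liu, arXiv:2102.11518 = Camb. J. Math. 9 (2021), Def. 4.3 (2) (`FJcycle.tex` l. 1919), Remark 4.4 (l. 1930–1933),
Def. 4.5 (l. 1936–1951), proof of Thm. 4.18 (l. 2246–2253); G. Shimura, *Abelian Varieties with Complex Multiplication and Modular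
Functions* (1998) §7.1 Prop. 7, §8.1 Prop. 25, §8.3 Prop. 28; D. Mumford, *Abelian Varieties* (1970) §19.  HC_CM is NOT proved.
-/

noncomputable section

open scoped TensorProduct Pointwise

namespace Summit.HodgeConjecture.CorCM.D2Bridge

open CategoryTheory NumberField
open Literature.AlgebraicGeometry.Motives Literature.AlgebraicGeometry.HodgeTheory
open Literature.AlgebraicGeometry.ComplexMultiplication
open Literature.NumberTheory.ComplexMultiplication Literature.NumberTheory.Automorphic
open Literature.NumberTheory.Automorphic.IdeleClassGroup Literature.NumberTheory.Automorphic.PicardCM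
open Literature.NumberTheory.Automorphic.Liu2021 Literature.NumberTheory.Automorphic.Liu2021.AppendixC.RestOne
open HodgeCM.Model (LiuCMSide)

/-! ## §1  `𝒜(μ)` through `ῑ₁` ↔ through `ι₁` -/

section ConjDatum

variable {L : Type} [Field L] [NumberField L] [IsCMField L]

variable [IsGalois ℚ L] {μ : Literature.NumberTheory.Automorphic.IdeleClassGroup L →ₜ* Circle} (hμ : IsConjugateSymplectic L μ)

/-- **`𝒜(μ)` presented through `ῑ₁` is inhabited iff it is through `ι₁`** — with the SAME `A_μ`, `i_μ`, carriers: the only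
presentation-dependent field of `Def45.CMDatum` is `det45`, through `η_μ`, and `η_μ(ῑ₁) = η_μ(ι₁)` (`Def45.eta_starRingEnd_comp`).
[cite: Liu2021, Def. 4.5 (2) (FJcycle.tex l. 1944–1951) and Remark 4.4 (l. 1930–1933)] -/
theorem nonempty_cmDatum_conj_iff (ι₁ : L →+* ℂ) (hw : HasWeight L μ 1) (Car : Def45.Carriers L μ) :
    Nonempty (Def45.CMDatum (AlgHom.id ℚ L) ((starRingEnd ℂ).comp ι₁) hμ hw Car) ↔
      Nonempty (Def45.CMDatum (AlgHom.id ℚ L) ι₁ hμ hw Car) := by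
  have e := Def45.eta_starRingEnd_comp (AlgHom.id ℚ L) ι₁ hμ
  constructor
  · rintro ⟨X⟩
    refine ⟨⟨X.A, X.i, X.finrank_eq, fun x M f hM h => ?_, X.isCMCharacter, X.polDR⟩⟩
    rw [← e]
    exact X.det45 x M f hM h
  · rintro ⟨X⟩
    refine ⟨⟨X.A, X.i, X.finrank_eq, fun x M f hM h => ?_, X.isCMCharacter, X.polDR⟩⟩
    rw [e]
    exact X.det45 x M f hM h

end ConjDatum

/-! ## §2  THE PRIMED TWIN of `exists_dLiu_of_objOne`: instance `ῑ₁`, the SHARED `ι₁`-presented tail, both admissibility readings -/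

section Junction

variable {L : HodgeCM.CMField} [IsGalois ℚ L] (ι₁ : L →+* ℂ)
  {μ : Literature.NumberTheory.Automorphic.IdeleClassGroup L →ₜ* Circle} (hμ : IsConjugateSymplectic L μ)
  (hw : HasWeight L μ 1) (Car : Def45.Carriers L μ)

/-- **Currency, instance-generic** (`baseChange_hOneAlgHom_of_lineModuleOne` for the AMBIENT `Algebra L ℂ`): the J-record's eigen-law for
`α₀` (`lineModuleOne`) IS the S1 core's `hα₀` (`hOneAlgHom` over `muAlgValueField`). [cite: Liu2021, §4.1 (FJcycle.tex l. 1926–1928) and proof of Thm. 4.18 (l. 2250)] -/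
theorem baseChange_hOneAlgHom_of_lineModuleOne_inst [Algebra (L : Type) ℂ] (D : ObjOne (AlgHom.id ℚ L) ι₁ hμ hw Car)
    (α₀ : ℂ ⊗[ℚ] bettiCohomology (AμC (AlgHom.id ℚ L) ι₁ hμ hw Car D).X 1)
    (hα₀ : letI := lineModuleOne (AlgHom.id ℚ L) ι₁ hμ hw Car D
      ∀ s : fieldOfValues L μ,
        (DistribSMul.toLinearMap ℚ (bettiCohomology (AμC (AlgHom.id ℚ L) ι₁ hμ hw Car D).X 1) s).baseChange ℂ α₀ =
          algebraMap (fieldOfValues L μ) ℂ s • α₀)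
    (k : muAlgValueField L μ) :
    haveI := hμ.numberField_muAlgValueField
    (hOneAlgHom ((AbelianVariety.endAlgebra.mapRingHom ((datum (AlgHom.id ℚ L) ι₁ hμ hw Car D).A.endBaseChange ℂ)).toRingHom.comp
        (datum (AlgHom.id ℚ L) ι₁ hμ hw Car D).i) k).baseChange ℂ α₀ = ((k : muAlgValueField L μ) : ℂ) • α₀ := by
  haveI := hμ.numberField_muAlgValueField
  let s : fieldOfValues L μ := ⟨(k : ℂ), (mem_fieldOfValues_iff L μ (k : ℂ)).2 k.2⟩
  have e : (letI := lineModuleOne (AlgHom.id ℚ L) ι₁ hμ hw Car D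
      DistribSMul.toLinearMap ℚ (bettiCohomology (AμC (AlgHom.id ℚ L) ι₁ hμ hw Car D).X 1) s) =
      hOneAlgHom ((AbelianVariety.endAlgebra.mapRingHom ((datum (AlgHom.id ℚ L) ι₁ hμ hw Car D).A.endBaseChange ℂ)).toRingHom.comp
        (datum (AlgHom.id ℚ L) ι₁ hμ hw Car D).i) k := by
    apply LinearMap.ext
    intro x
    rw [hOneAlgHom_apply]
    rfl
  have h := hα₀ s
  rw [e] at h
  exact h

/-- **THE S1 JUNCTION OF THE PIECES PIN — PRIMED TWIN: instance `ῑ₁ = conj ∘ ι₁`, on the SHARED `ι₁`-presented tail.**  For `L`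
Galois CM, any `Algebra L ℂ` structure THROUGH `ῑ₁` (`hinst`), a conjugate-symplectic weight-one `μ`, the one object
`D : ObjOne (AlgHom.id ℚ L) ι₁ …` of [Liu2021] Def. 4.5 (2) presented through `ι₁` (the tail OF RECORD of `PinSignatures`), and a NON-ZERO
eigenclass `α₀ ∈ ℂ ⊗ H¹_B(A_μ ⊗_{L,ῑ₁} ℂ; ℚ)` for `M_μ ⊆ ℂ` in the J-record's currency: there are a `ℚ`-family of model CM records
`dLiu q : LiuCMSide` — Liu's own datum on the principal model `B` of `A_μ ⊗_{L,ῑ₁} ℂ` (reflex data presented through `ῑ₁`, CM type the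
inflated reflex type `Ψ̃_μ(ῑ₁) = conj · Ψ̃_μ(ι₁)`, class `q • α'`) — and ONE isogeny `u : A_μ ⊗_{ῑ₁} ℂ ⟶ B` with the S4 transport law
`(f ≫ u)^*_ℂ (dLiu q).α = (q : ℂ) • f^*_ℂ α₀`, such that `dLiu q` is admissible in the `ῑ₁`-reading for `Φ_μ` — equivalently (✔ `ReflexOfTypeConj.isReflexOfTypeG_conj_iff`, one
rewrite for the consumer) in the DICTIONARY's `ι₁`-reading `IsReflexOfTypeG ι₁ Φ̄_μ` for the CONJUGATE type `Φ̄_μ = CMTypeOps.bar Φ_μ`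
(= `Φ_{μ^c}`, [Liu2021] Remark 4.4).  The datum fed to the S1 core `exists_liuCMRecord_of_cmDatum ῑ₁` is the SAME `(A_μ, i_μ, carriers)` of
`datum D`, its first bullet transported along `Def45.eta_starRingEnd_comp` (`η_μ` does not see `ι₁ ↦ ῑ₁`) — no second tail.
NOT CLAIMED: admissibility in the `ι₁`-reading for `Φ_μ` ITSELF under this instance (it is false when `ι₁ ∈ Φ_μ`: the wall certificate,
sibling file `HcmS1PinJunctionConjObstruction`).  HC_CM is NOT proved; «Δ2 BRIDGE CLOSED» is NOT claimed.
[cite: Liu2021, Def. 4.5 (2) (FJcycle.tex l. 1944–1951), Def. 4.3 (2) (l. 1919), Remark 4.4 (l. 1930–1933), proof of Thm. 4.18 (l. 2246–2253)]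
[cite: Shimura1998, §7.1 Proposition 7 (p. 47), §8.1 Prop. 25 and §8.3 Prop. 28] [cite: MumfordAV1970, §19 Remark p. 169] -/
theorem exists_dLiu_of_objOne_conj [inst : Algebra (L : Type) ℂ]
    (hinst : ∀ x : L, algebraMap (L : Type) ℂ x = ((starRingEnd ℂ).comp ι₁) x)
    (D : ObjOne (AlgHom.id ℚ L) ι₁ hμ hw Car)
    (α₀ : ℂ ⊗[ℚ] bettiCohomology (AμC (AlgHom.id ℚ L) ι₁ hμ hw Car D).X 1)
    (hα₀ : letI := lineModuleOne (AlgHom.id ℚ L) ι₁ hμ hw Car D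
      ∀ s : fieldOfValues L μ,
        (DistribSMul.toLinearMap ℚ (bettiCohomology (AμC (AlgHom.id ℚ L) ι₁ hμ hw Car D).X 1) s).baseChange ℂ α₀ =
          algebraMap (fieldOfValues L μ) ℂ s • α₀)
    (hα₀0 : α₀ ≠ 0) :
    ∃ (dLiu : ℚ → LiuCMSide) (u : ∀ q : ℚ, (AμC (AlgHom.id ℚ L) ι₁ hμ hw Car D).X ⟶ (dLiu q).A.X),
      (∀ Φ' : CMType L, hμ.cmType = Φ' → ∀ q : ℚ, (dLiu q).IsReflexOfTypeG ((starRingEnd ℂ).comp ι₁) Φ') ∧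
      ∀ (q : ℚ) (Y : SchemeOver ℂ) (f : Y ⟶ (AμC (AlgHom.id ℚ L) ι₁ hμ hw Car D).X),
        (BettiUniverse.pull (f ≫ u q) 1).baseChange ℂ (dLiu q).α = (q : ℂ) • (BettiUniverse.pull f 1).baseChange ℂ α₀ := by
  have hα₀' := baseChange_hOneAlgHom_of_lineModuleOne_inst ι₁ hμ hw Car D α₀ hα₀
  obtain rfl : inst = ((starRingEnd ℂ).comp ι₁).toAlgebra := Algebra.algebra_ext _ _ hinst
  haveI := hμ.numberField_muAlgValueField
  -- the SHARED tail's datum `D_μ`, RE-PRESENTED through `ῑ₁`: same `A_μ`, `i_μ`, carriers; `det45` transported along `Def45.eta_starRingEnd_comp`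
  obtain ⟨B, u, ιB, θB, hB, α', -, hα', -, hlaw⟩ :=
    exists_liuCMRecord_of_cmDatum ((starRingEnd ℂ).comp ι₁)
      (⟨(datum (AlgHom.id ℚ L) ι₁ hμ hw Car D).A, (datum (AlgHom.id ℚ L) ι₁ hμ hw Car D).i,
        (datum (AlgHom.id ℚ L) ι₁ hμ hw Car D).finrank_eq,
        fun x M f hM h => by rw [Def45.eta_starRingEnd_comp (AlgHom.id ℚ L) ι₁ hμ]; exact (datum (AlgHom.id ℚ L) ι₁ hμ hw Car D).det45 x M f hM h,
        (datum (AlgHom.id ℚ L) ι₁ hμ hw Car D).isCMCharacter, (datum (AlgHom.id ℚ L) ι₁ hμ hw Car D).polDR⟩ :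
        Def45.CMDatum (AlgHom.id ℚ L) ((starRingEnd ℂ).comp ι₁) hμ hw Car) α₀ hα₀' hα₀0
  -- (b) admissibility in the ῑ₁-reading, for `Φ' = Φ_μ` (R2 at `ῑ₁`, verbatim the landed junction's step)
  have hb : ∀ q : ℚ, HodgeCM.Model.LiuCMSide.IsReflexOfTypeG ((starRingEnd ℂ).comp ι₁)
      ({ K' := ↥(reflexField ℚ L (algValuedIn ((starRingEnd ℂ).comp ι₁) hμ.cmType.1))
         Φ' := (reflexCMType ((starRingEnd ℂ).comp ι₁) hμ.cmType (AlgHom.id ℚ L)).1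
         M := ↥(muAlgValueField L μ)
         instNumberFieldM := hμ.numberField_muAlgValueField
         k := Def45.incl (AlgHom.id ℚ L) ((starRingEnd ℂ).comp ι₁) hμ
         A := B, ιA := ιB, θA := θB
         ΦA := inducedCMType (Def45.incl (AlgHom.id ℚ L) ((starRingEnd ℂ).comp ι₁) hμ)
           (reflexCMType ((starRingEnd ℂ).comp ι₁) hμ.cmType (AlgHom.id ℚ L))
         hΦA := fun θ => mem_inducedCMType_iff _ _ θ
         isRealisation := hB
         τ := (muAlgValueField L μ).subtype
         α := (q : ℂ) • α'
         α_mem := Submodule.smul_mem _ _ hα' } : LiuCMSide) hμ.cmType := fun q _ =>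
    Transposition.isReflexOfType_of_reflexCMType ((starRingEnd ℂ).comp ι₁) hμ.cmType _ (RingEquiv.refl _)
      (RingHom.ext fun k => Def45.coe_incl (AlgHom.id ℚ L) ((starRingEnd ℂ).comp ι₁) hμ k)
      (fun _ => Iff.of_eq (congrArg (fun χ => χ ∈ (reflexCMType ((starRingEnd ℂ).comp ι₁) hμ.cmType (AlgHom.id ℚ L)).1)
        (RingHom.ext fun _ => rfl)))
  refine ⟨fun q =>
    { K' := ↥(reflexField ℚ L (algValuedIn ((starRingEnd ℂ).comp ι₁) hμ.cmType.1))
      Φ' := (reflexCMType ((starRingEnd ℂ).comp ι₁) hμ.cmType (AlgHom.id ℚ L)).1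
      M := ↥(muAlgValueField L μ)
      instNumberFieldM := hμ.numberField_muAlgValueField
      k := Def45.incl (AlgHom.id ℚ L) ((starRingEnd ℂ).comp ι₁) hμ
      A := B, ιA := ιB, θA := θB
      ΦA := inducedCMType (Def45.incl (AlgHom.id ℚ L) ((starRingEnd ℂ).comp ι₁) hμ)
        (reflexCMType ((starRingEnd ℂ).comp ι₁) hμ.cmType (AlgHom.id ℚ L))
      hΦA := fun θ => mem_inducedCMType_iff _ _ θ
      isRealisation := hB
      τ := (muAlgValueField L μ).subtype
      α := (q : ℂ) • α'
      α_mem := Submodule.smul_mem _ _ hα' }, fun _ => u.hom.hom.hom, ?_, fun q Y f => ?_⟩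
  · rintro Φ' rfl q
    exact hb q
  · -- `(f ≫ u)^* (q • α') = q • (f ≫ u)^* α' = q • f^* α₀`
    refine (map_smul ((BettiUniverse.pull (f ≫ u.hom.hom.hom) 1).baseChange ℂ) (q : ℂ) α').trans ?_
    exact congrArg (fun x => (q : ℂ) • x) (hlaw Y f)

end Junction

end Summit.HodgeConjecture.CorCM.D2Bridge

end
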